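import Summits.NavierStokesRegularity.NavierStokesRegularity.Theorems.Target.Negative.EnergyClassLoadBearing
import Literature.Analysis.FluidPDE.SereginSverak2002PressureLowerBoundProofs
import Literature.Analysis.FluidPDE.NSLerayHopfABCScaling
import Literature.Analysis.FluidPDE.ClassicalSolutionRescale
import Literature.Analysis.FluidPDE.LerayHopfNSRescale

/-!
# Crux `Target` = `TypeICertificateLadder.NoTypeIBlowup` (stmt-NavierStokesRegularity-1217), negative side:
# normal forms — `0 < T` is decoration, WLOG `ν = T = 1`

Negative-side (cdisprove, D-0016) structure theorems extracted from the crux work file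
`Cruxes/Target/Disproof.lean` §§5, 6 (gen 1–3), importable by provers:

* `targetWithoutTpos_iff : TargetWithoutTpos ↔ Target` — the hypothesis `0 < T` is decoration
  (for `T ≤ 0` the rest flow on `[0, 1)` is a classical extension of anything);
* `target_iff_unit : Target ↔ TargetAt 1 1` — NORMAL FORM: the viscosity normalisation
  `v(s, x) = ν⁻¹ u(s/ν, x)` (Tao 2013, fn. 3; Type-I constant `C ↦ C/√ν`;
  `targetAt_of_viscosity_one`) and Leray's similarity `w(s, y) = √T u(Ts, √T y)` (constant
  invariant; `targetAt_one_of_unit`) transport all five clauses and the conclusion; with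
  `CounterexampleProfile.counterexample_typeI_constant_ge` a counterexample search has ONE
  dimensionless parameter `C ≥ c_Leray`. Helper `hasRapidSpatialDecay_nsRescaleData` (Schwartz
  decay is dilation invariant);
(The second normal form — the rate on ALL of `[0, T)` — and the adversary's witness form live in
the sibling `KillNormalForm.lean`, which needs `CounterexampleProfile.pointwise_bounded_before`.)

Nothing here closes the item (`--supports`). [folklore]
-/

noncomputable section

open MeasureTheory TopologicalSpace Set Function Filter Metric
open scoped Topology RealInnerProductSpace ContDiff Laplacian InnerProductSpace
open Literature.Analysis.FluidPDE

namespace Summit.NavierStokesRegularity.NavierStokesRegularity.Theorems.Target.Negative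

/-- Local notation for physical space `ℝ³ = EuclideanSpace ℝ (Fin 3)`. -/
local notation "ℝ³" => EuclideanSpace ℝ (Fin 3)

/-! ## §5 `0 < T` is not load-bearing -/

section Tpos

/-- For `T ≤ 0` the conclusion holds for every field: the interval `[0, T)` is empty and the rest
flow on `[0, 1)` is a classical extension. -/
theorem hasSmoothExtensionPast_of_nonpos {ν T : ℝ} (hT : T ≤ 0) (u : ℝ → ℝ³ → ℝ³) :
    HasSmoothExtensionPast ν 0 u T := by
  refine ⟨1, by linarith, uniformVel (fun _ => 0) e₀,
    uniformPres (derivWithin (fun _ => (0 : ℝ)) (Ico 0 1)) e₀,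
    isClassicalNSSolutionOn_uniform (uniqueDiffOn_Ico 0 1) contDiffOn_const ν e₀, fun t ht => ?_⟩
  exact absurd ht.2 (not_lt.2 (hT.trans ht.1))

/-- The crux with the hypothesis `0 < T` DELETED. -/
def TargetWithoutTpos : Prop :=
  ∀ (ν T : ℝ), 0 < ν → ∀ (u : ℝ → ℝ³ → ℝ³) (p : ℝ → ℝ³ → ℝ),
    IsClassicalNSSolutionOn (Set.Ico 0 T) ν 0 u p → IsLerayHopfOn T ν 0 (u 0) u →
    HasRapidSpatialDecay (u 0) → IsTypeIBlowup u T → HasSmoothExtensionPast ν 0 u T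

/-- `0 < T` is decoration: the crux is equivalent to its `T`-unrestricted form. -/
theorem targetWithoutTpos_iff : TargetWithoutTpos ↔ Target := by
  constructor
  · exact fun h ν T hν _ u p hcl hLH hdec hI => h ν T hν u p hcl hLH hdec hI
  · intro h ν T hν u p hcl hLH hdec hI
    rcases le_or_gt T 0 with hT | hT
    · exact hasSmoothExtensionPast_of_nonpos hT u
    · exact h ν T hν hT u p hcl hLH hdec hI

end Tpos

/-! ## §6 Normal form `ν = 1`, `T = 1` (one dimensionless parameter)

Both symmetries of the problem act on ALL five clauses of the crux and on its conclusion: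
the viscosity normalisation `v(s, x) = ν⁻¹ u(s/ν, x)` (Tao 2013, footnote 3) maps
`(ν, T) ↦ (1, νT)` with Type-I constant `C ↦ C/√ν`, and Leray's similarity
`w(s, y) = √T u(T s, √T y)` maps `(1, T) ↦ (1, 1)` keeping the constant. Hence
`target_iff_unit : Target ↔ TargetAt 1 1` — provers may assume `ν = T = 1`, and a counterexample
search has the single parameter `C ≥ c_Leray` (§4). -/

section NormalForm

/-- The crux at fixed viscosity and lifespan. -/
def TargetAt (ν T : ℝ) : Prop :=
  ∀ (u : ℝ → ℝ³ → ℝ³) (p : ℝ → ℝ³ → ℝ),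
    IsClassicalNSSolutionOn (Set.Ico 0 T) ν 0 u p → IsLerayHopfOn T ν 0 (u 0) u →
    HasRapidSpatialDecay (u 0) → IsTypeIBlowup u T → HasSmoothExtensionPast ν 0 u T

/-- The crux, fibrewise in `(ν, T)` (definitional). -/
theorem target_iff_forall_targetAt : Target ↔ ∀ ν T : ℝ, 0 < ν → 0 < T → TargetAt ν T :=
  Iff.rfl

/-- Rapid decay is preserved by the Navier–Stokes dilation of data `x ↦ c u₀(c x)`, `c > 0`
(chain rule for `iteratedFDeriv` through the linear map `c • id`, and
`1 + ‖x‖ ≤ max 1 c⁻¹ · (1 + c‖x‖)`). -/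
theorem hasRapidSpatialDecay_nsRescaleData {u₀ : ℝ³ → ℝ³} (hu : ContDiff ℝ ∞ u₀)
    (hd : HasRapidSpatialDecay u₀) {c : ℝ} (hc : 0 < c) :
    HasRapidSpatialDecay (nsRescaleData c u₀) := by
  intro n K
  obtain ⟨C, hC⟩ := hd n K
  have hC0 : 0 ≤ C := le_trans (by positivity) (hC 0)
  set m : ℝ := max 1 c⁻¹ with hm
  have hm0 : 0 ≤ m := le_trans zero_le_one (le_max_left _ _)
  refine ⟨m ^ K * (c * c ^ n) * C, fun x => ?_⟩
  set L : ℝ³ →L[ℝ] ℝ³ := c • ContinuousLinearMap.id ℝ ℝ³ with hL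
  have hLx : ∀ y : ℝ³, L y = c • y := fun y => by simp [hL]
  have hfun : nsRescaleData c u₀ = c • (u₀ ∘ ⇑L) := by
    funext y
    simp [nsRescaleData_apply, hLx]
  have hun : ContDiff ℝ n u₀ := hu.of_le (by exact_mod_cast le_top)
  have hcomp : ContDiff ℝ n (u₀ ∘ ⇑L) := hun.comp L.contDiff
  have hnorm_L : ‖L‖ ≤ c := by
    rw [hL]
    calc ‖c • ContinuousLinearMap.id ℝ ℝ³‖ ≤ ‖c‖ * ‖ContinuousLinearMap.id ℝ ℝ³‖ :=
          (norm_smul c (ContinuousLinearMap.id ℝ ℝ³)).le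
      _ ≤ c * 1 := by
          rw [Real.norm_eq_abs, abs_of_pos hc]
          exact mul_le_mul_of_nonneg_left ContinuousLinearMap.norm_id_le hc.le
      _ = c := mul_one c
  -- the derivative of the dilated field
  have hD : ‖iteratedFDeriv ℝ n (nsRescaleData c u₀) x‖ ≤
      c * c ^ n * ‖iteratedFDeriv ℝ n u₀ (L x)‖ := by
    rw [hfun, iteratedFDeriv_const_smul_apply hcomp.contDiffAt, norm_smul, Real.norm_eq_abs,
      abs_of_pos hc, L.iteratedFDeriv_comp_right hun x le_rfl, mul_assoc]
    refine mul_le_mul_of_nonneg_left ?_ hc.le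
    calc ‖(iteratedFDeriv ℝ n u₀ (L x)).compContinuousLinearMap fun _ => L‖
        ≤ ‖iteratedFDeriv ℝ n u₀ (L x)‖ * ∏ _i : Fin n, ‖L‖ :=
          ContinuousMultilinearMap.norm_compContinuousLinearMap_le _ _
      _ ≤ ‖iteratedFDeriv ℝ n u₀ (L x)‖ * c ^ n := by
          rw [Finset.prod_const, Finset.card_univ, Fintype.card_fin]
          exact mul_le_mul_of_nonneg_left (pow_le_pow_left₀ (norm_nonneg _) hnorm_L n) (norm_nonneg _)
      _ = c ^ n * ‖iteratedFDeriv ℝ n u₀ (L x)‖ := mul_comm _ _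
  -- the weight
  have hw : 1 + ‖x‖ ≤ m * (1 + ‖L x‖) := by
    rw [hLx, norm_smul, Real.norm_eq_abs, abs_of_pos hc, mul_add, mul_one]
    have h1 : (1 : ℝ) ≤ m := le_max_left _ _
    have h2 : ‖x‖ ≤ m * (c * ‖x‖) := by
      calc ‖x‖ = c⁻¹ * (c * ‖x‖) := by rw [← mul_assoc, inv_mul_cancel₀ hc.ne', one_mul]
        _ ≤ m * (c * ‖x‖) := mul_le_mul_of_nonneg_right (le_max_right _ _) (by positivity)
    linarith
  have hwK : (1 + ‖x‖) ^ K ≤ m ^ K * (1 + ‖L x‖) ^ K := by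
    rw [← mul_pow]
    exact pow_le_pow_left₀ (by positivity) hw K
  calc (1 + ‖x‖) ^ K * ‖iteratedFDeriv ℝ n (nsRescaleData c u₀) x‖
      ≤ (m ^ K * (1 + ‖L x‖) ^ K) * (c * c ^ n * ‖iteratedFDeriv ℝ n u₀ (L x)‖) :=
        mul_le_mul hwK hD (norm_nonneg _) (by positivity)
    _ = m ^ K * (c * c ^ n) * ((1 + ‖L x‖) ^ K * ‖iteratedFDeriv ℝ n u₀ (L x)‖) := by ring
    _ ≤ m ^ K * (c * c ^ n) * C := mul_le_mul_of_nonneg_left (hC (L x)) (by positivity)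

/-- An affine increasing reparametrisation of time maps left neighbourhoods to left neighbourhoods. -/
theorem tendsto_const_mul_nhdsLT {a T : ℝ} (ha : 0 < a) :
    Tendsto (fun s : ℝ => a * s) (𝓝[<] (a⁻¹ * T)) (𝓝[<] T) := by
  refine tendsto_nhdsWithin_iff.2 ⟨?_, ?_⟩
  · have h : Tendsto (fun s : ℝ => a * s) (𝓝 (a⁻¹ * T)) (𝓝 (a * (a⁻¹ * T))) :=
      (continuous_const.mul continuous_id).tendsto _
    rw [← mul_assoc, mul_inv_cancel₀ ha.ne', one_mul] at h
    exact h.mono_left nhdsWithin_le_nhds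
  · filter_upwards [self_mem_nhdsWithin] with s hs
    have hs' : s < a⁻¹ * T := hs
    show a * s < T
    calc a * s < a * (a⁻¹ * T) := mul_lt_mul_of_pos_left hs' ha
      _ = T := by rw [← mul_assoc, mul_inv_cancel₀ ha.ne', one_mul]

/-- **Viscosity normalisation**: the crux at viscosity `1` (all lifespans) gives the crux at every
viscosity. Type-I constants transform as `C ↦ C/√ν`. -/
theorem targetAt_of_viscosity_one (h1 : ∀ T : ℝ, 0 < T → TargetAt 1 T) {ν T : ℝ} (hν : 0 < ν)
    (hT : 0 < T) : TargetAt ν T := by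
  intro u p hcl hLH hdec hI
  have hν0 : ν ≠ 0 := hν.ne'
  have hνi : 0 < ν⁻¹ := inv_pos.2 hν
  have hνT : 0 < ν * T := mul_pos hν hT
  set v : ℝ → ℝ³ → ℝ³ := timeRescale ν⁻¹ ν⁻¹ u with hv
  set π : ℝ → ℝ³ → ℝ := timeRescale ν⁻¹ (ν⁻¹ ^ 2) p with hπ
  have hmaps : MapsTo (fun s => ν⁻¹ * s) (Ico 0 (ν * T)) (Ico 0 T) := by
    intro s hs
    refine ⟨mul_nonneg hνi.le hs.1, ?_⟩
    calc ν⁻¹ * s < ν⁻¹ * (ν * T) := mul_lt_mul_of_pos_left hs.2 hνi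
      _ = T := by rw [← mul_assoc, inv_mul_cancel₀ hν0, one_mul]
  -- (1) classical at viscosity 1 on `[0, νT)`
  have hclv : IsClassicalNSSolutionOn (Ico 0 (ν * T)) 1 0 v π := by
    have h := hcl.viscosityRescale_set hν0 hmaps (uniqueDiffOn_Ico 0 (ν * T))
    rwa [timeRescale_zero_force] at h
  -- (2) Leray–Hopf
  have hv0 : ν⁻¹ • u 0 = v 0 := by
    funext x
    simp [hv]
  have hLHv : IsLerayHopfOn (ν * T) 1 0 (v 0) v := by
    have h := hLH.viscosityRescale hνi
    have e1 : T / ν⁻¹ = ν * T := by rw [div_inv_eq_mul, mul_comm]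
    rwa [e1, inv_mul_cancel₀ hν0, timeRescale_zero_force, hv0] at h
  -- (3) decay of the datum
  have hdecv : HasRapidSpatialDecay (v 0) := by
    rw [← hv0]
    exact SereginSverak2002_pressureOneSidedBound.hasRapidSpatialDecay_const_smul
      (hcl.contDiff_velocity ⟨le_rfl, hT⟩) hdec ν⁻¹
  -- (4) Type-I with constant `ν⁻¹ C √ν`
  have hIv : IsTypeIBlowup v (ν * T) := by
    obtain ⟨C, hC⟩ := hI
    refine ⟨ν⁻¹ * C * Real.sqrt ν, ?_⟩
    have ht : Tendsto (fun s : ℝ => ν⁻¹ * s) (𝓝[<] (ν * T)) (𝓝[<] T) := by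
      have := tendsto_const_mul_nhdsLT (T := T) hνi
      rwa [inv_inv] at this
    filter_upwards [ht.eventually hC, self_mem_nhdsWithin] with s hs hsT x
    have hsT' : s < ν * T := hsT
    have hpos : 0 < ν * T - s := sub_pos.2 hsT'
    have e : T - ν⁻¹ * s = ν⁻¹ * (ν * T - s) := by field_simp
    have hsq : Real.sqrt (T - ν⁻¹ * s) = (Real.sqrt ν)⁻¹ * Real.sqrt (ν * T - s) := by
      rw [e, Real.sqrt_mul hνi.le, Real.sqrt_inv]
    have hb := hs x
    show ‖ν⁻¹ • u (ν⁻¹ * s) x‖ ≤ ν⁻¹ * C * Real.sqrt ν / Real.sqrt (ν * T - s)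
    rw [norm_smul, Real.norm_eq_abs, abs_of_pos hνi]
    have hsν : 0 < Real.sqrt ν := Real.sqrt_pos.2 hν
    have hsr : 0 < Real.sqrt (ν * T - s) := Real.sqrt_pos.2 hpos
    calc ν⁻¹ * ‖u (ν⁻¹ * s) x‖ ≤ ν⁻¹ * (C / Real.sqrt (T - ν⁻¹ * s)) :=
          mul_le_mul_of_nonneg_left hb hνi.le
      _ = ν⁻¹ * C * Real.sqrt ν / Real.sqrt (ν * T - s) := by
          rw [hsq]
          field_simp
  -- (5) conclude at viscosity 1 and transport the extension back
  obtain ⟨T₁', hT₁', v', π', hcl', hagree'⟩ := h1 (ν * T) hνT v π hclv hLHv hdecv hIv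
  have key := hcl'.stRescale hν one_pos (by rw [mul_one]) 0 0
  have hset : ((fun r => (0 : ℝ) + ν * r) ⁻¹' Ico 0 T₁') = Ico 0 (T₁' / ν) := by
    ext r
    simp only [mem_preimage, zero_add, mem_Ico]
    rw [lt_div_iff₀ hν, mul_comm r ν]
    constructor
    · rintro ⟨h0, h1⟩; exact ⟨nonneg_of_mul_nonneg_right (by linarith) hν |> fun h => by nlinarith [h0], h1⟩
    · rintro ⟨h0, h1⟩; exact ⟨by positivity, h1⟩
  rw [hset, smul_stPull_zero, show ν * (1 : ℝ) / 1 = ν by simp] at key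
  refine ⟨T₁' / ν, by rw [gt_iff_lt, lt_div_iff₀ hν, mul_comm]; exact hT₁', _, _, key, fun t ht => ?_⟩
  funext x
  have hνt : ν * t ∈ Ico 0 (ν * T) := ⟨mul_nonneg hν.le ht.1, mul_lt_mul_of_pos_left ht.2 hν⟩
  show ν • v' (0 + ν * t) (0 + (1 : ℝ) • x) = u t x
  rw [zero_add, zero_add, one_smul, hagree' (ν * t) hνt]
  show ν • (ν⁻¹ • u (ν⁻¹ * (ν * t)) x) = u t x
  rw [← mul_assoc, inv_mul_cancel₀ hν0, one_mul, smul_smul, mul_inv_cancel₀ hν0, one_smul]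

/-- **Time normalisation** (Leray's similarity at fixed viscosity): the crux at `ν = 1`, `T = 1`
gives the crux at `ν = 1` for every lifespan. The Type-I constant is invariant. -/
theorem targetAt_one_of_unit (h11 : TargetAt 1 1) {T : ℝ} (hT : 0 < T) : TargetAt 1 T := by
  intro u p hcl hLH hdec hI
  set c : ℝ := Real.sqrt T with hc
  have hcpos : 0 < c := Real.sqrt_pos.2 hT
  have hc2 : c ^ 2 = T := Real.sq_sqrt hT.le
  set w : ℝ → ℝ³ → ℝ³ := nsRescale c u with hw
  set ϖ : ℝ → ℝ³ → ℝ := nsRescalePressure c p with hϖ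
  -- (1) classical on `[0, 1)`
  have hset : ((fun t => c ^ 2 * t) ⁻¹' Ico 0 T) = Ico 0 1 := by
    ext t
    simp only [mem_preimage, mem_Ico, hc2]
    constructor
    · rintro ⟨h0, h1⟩
      exact ⟨nonneg_of_mul_nonneg_right h0 hT, by nlinarith⟩
    · rintro ⟨h0, h1⟩
      exact ⟨by positivity, by nlinarith⟩
  have hclw : IsClassicalNSSolutionOn (Ico 0 1) 1 0 w ϖ := by
    have h := IsClassicalNSSolutionOn.nsRescale_holds hcl hcpos
    rwa [hset, nsRescaleForce_zero] at h
  -- (2) Leray–Hopf on `[0, 1)`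
  have hw0 : nsRescaleData c (u 0) = w 0 := by
    funext x
    simp [hw, nsRescale_apply, nsRescaleData_apply]
  have hLHw : IsLerayHopfOn 1 1 0 (w 0) w := by
    have h := IsLerayHopfOn.nsRescale_holds hLH hcpos
    rwa [hc2, div_self hT.ne', nsRescaleForce_zero, hw0] at h
  -- (3) decay
  have hdecw : HasRapidSpatialDecay (w 0) := by
    rw [← hw0]
    exact hasRapidSpatialDecay_nsRescaleData (hcl.contDiff_velocity ⟨le_rfl, hT⟩) hdec hcpos
  -- (4) Type-I, same constant
  have hIw : IsTypeIBlowup w 1 := by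
    obtain ⟨C, hC⟩ := hI
    refine ⟨C, ?_⟩
    have ht : Tendsto (fun s : ℝ => c ^ 2 * s) (𝓝[<] 1) (𝓝[<] T) := by
      have := tendsto_const_mul_nhdsLT (T := T) (pow_pos hcpos 2)
      rw [hc2, inv_mul_cancel₀ hT.ne'] at this
      rwa [hc2]
    filter_upwards [ht.eventually hC, self_mem_nhdsWithin] with s hs hs1 x
    have hs1' : s < 1 := hs1
    have hpos : 0 < 1 - s := sub_pos.2 hs1'
    have hb := hs (c • x)
    show ‖c • u (c ^ 2 * s) (c • x)‖ ≤ C / Real.sqrt (1 - s)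
    rw [norm_smul, Real.norm_eq_abs, abs_of_pos hcpos]
    have hsq : Real.sqrt (T - c ^ 2 * s) = c * Real.sqrt (1 - s) := by
      rw [hc2, show T - T * s = T * (1 - s) by ring, Real.sqrt_mul hT.le, ← hc]
    have hsr : 0 < Real.sqrt (1 - s) := Real.sqrt_pos.2 hpos
    calc c * ‖u (c ^ 2 * s) (c • x)‖ ≤ c * (C / Real.sqrt (T - c ^ 2 * s)) :=
          mul_le_mul_of_nonneg_left hb hcpos.le
      _ = C / Real.sqrt (1 - s) := by rw [hsq]; field_simp
  -- (5) conclude and scale the extension back with `c⁻¹`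
  obtain ⟨T₂', hT₂', w', ϖ', hcl', hagree'⟩ := h11 w ϖ hclw hLHw hdecw hIw
  have hci : 0 < c⁻¹ := inv_pos.2 hcpos
  have key := IsClassicalNSSolutionOn.nsRescale_holds hcl' hci
  have hset' : ((fun t => c⁻¹ ^ 2 * t) ⁻¹' Ico 0 T₂') = Ico 0 (T * T₂') := by
    ext t
    simp only [mem_preimage, mem_Ico, inv_pow, hc2]
    rw [← div_eq_inv_mul, le_div_iff₀ hT, div_lt_iff₀ hT, zero_mul, mul_comm T₂' T]
  rw [hset', nsRescaleForce_zero] at key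
  refine ⟨T * T₂', by nlinarith, _, _, key, fun t ht => ?_⟩
  funext x
  have hts : c⁻¹ ^ 2 * t ∈ Ico 0 1 := by
    rw [inv_pow, hc2, ← div_eq_inv_mul]
    exact ⟨div_nonneg ht.1 hT.le, (div_lt_one hT).2 ht.2⟩
  show c⁻¹ • w' (c⁻¹ ^ 2 * t) (c⁻¹ • x) = u t x
  rw [hagree' _ hts]
  show c⁻¹ • (c • u (c ^ 2 * (c⁻¹ ^ 2 * t)) (c • c⁻¹ • x)) = u t x
  rw [smul_smul, smul_smul, inv_mul_cancel₀ hcpos.ne', one_smul, mul_inv_cancel₀ hcpos.ne', one_smul,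
    ← mul_assoc, ← mul_pow, mul_inv_cancel₀ hcpos.ne', one_pow, one_mul]

/-- **Normal form.** The crux is equivalent to its instance `ν = 1`, `T = 1`. -/
theorem target_iff_unit : Target ↔ TargetAt 1 1 :=
  ⟨fun h => h 1 1 one_pos one_pos,
    fun h11 _ν _T hν hT => targetAt_of_viscosity_one (fun _T' hT' => targetAt_one_of_unit h11 hT') hν hT⟩

end NormalForm



end Summit.NavierStokesRegularity.NavierStokesRegularity.Theorems.Target.Negative

end
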